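import Summits.RiemannHypothesis.RiemannHypothesis.Theorems.HandoffLadderRungs
import Summits.RiemannHypothesis.RiemannHypothesis.Theorems.HandoffUpperClauses
import Summits.RiemannHypothesis.RiemannHypothesis.Theorems.HandoffEnergyMarginStatus
import HarnessLib

/-!
# HANDOFF — the WIDE rungs of the H-ladder and the coordinator's T2 target «H(q) for every prime q ≤ 73» as ONE certificate (cell rh-explicit, TRACK «HANDOFF», seat theory-2 gen7, file XII-n)

HONEST FRAMING. Nothing here bears on the truth of RH and no certificate is proved here. `HandoffLadderRungs` stops at the
`t = 2` column (`H(q)` for all primes `q < 53`); the PROVABLE-NOW target T2 of RH-PROMISE § 0′ is worded «`H(q)` CERTIFIED for all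
primes `q ≤ 73`», whose last window ends at `(log 79)/2 = 2.1847…`. This file does the remaining bookkeeping in the kernel:

* §1 DOWNWARD CLOSURE (the conjuncts are nested, `HandoffWindow.handoffH_anti`): `H(Q)` for ONE prime `Q` gives `H(q)` for every prime
  `q ≤ Q` (`forall_handoffH_of_handoffH`), so «`H(q)` for all primes `q ≤ Q`» is the single statement `H(Q)`
  (`forall_handoffH_le_iff`), i.e. `WeilPositivityOn ((log Q⁺)/2)`, i.e. the two sector inequalities `0 ≤ ε_ev`, `0 ≤ ε_od` at
  `(log Q⁺)/2` (`forall_handoffH_le_iff_sector_energies`).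
* §2 THE T2 SENTENCE: `nextPrime 73 = 79` and **`(∀ primes q ≤ 73, H(q)) ↔ H(73) ↔ WeilPositivityOn ((log 79)/2) ↔
  0 ≤ ε_ev((log 79)/2) ∧ 0 ≤ ε_od((log 79)/2)`** — ONE custodian-verified two-sector bracket at `c = (log 79)/2` (or any `c` above it)
  is exactly what «certified for all `q ≤ 73`» means at `N = ∞`; nothing short of it is (the statement IS `H(73)`).
* §3 THE WIDE TABLE (kernel arithmetic `P ≤ e^{2c}` as in `HandoffLadderRungs.natCast_le_exp_of_pow_lt`):

| `c` | `21/10` | `11/5` | `(log 79)/2` | `9/4` | `5/2` | `3` |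
|---|---|---|---|---|---|---|
| `H(q)` for all primes `q <` | `61` | `79` | `79` | `89` | `139` | `401` |

(`61^5 < e^{21}`, `79^5 < e^{22}`, `89^2 < e^{9}`, `139 < e^{5}`, `401 < e^{6}`). So a two-sector certificate at `t = 11/5 = 2.2` closes T2's
list `q ≤ 73`; at `t = 5/2` it reaches `q ≤ 137`; at `t = 3`, `q ≤ 397`. Whether such certificates exist is A1's certified numerics
(K(t)-closure brackets; at `t = 2` the two sector objects are in production, 2026-08-24), not a tree fact.

References: E. Bombieri, Rend. Mat. Acc. Lincei (9) 11 (2000) §4 (`Bombieri2000Weil`: windows, Thm 5 monotonicity); H. Yoshida, Adv. Stud.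
Pure Math. 21 (1992) Prop. 6 p. 320 (`Yoshida1992HermitianForms`: thresholds). The table is this track's bookkeeping.
-/

set_option linter.dupNamespace false  -- the mandated namespace repeats `RiemannHypothesis`

noncomputable section

open Set Literature.NumberTheory.LFunctions
open Summit.RiemannHypothesis.RiemannHypothesis.Theorems.Handoff (ConsecutivePrimes)
open Summit.RiemannHypothesis.RiemannHypothesis.Theorems.HandoffDecomposition
open Summit.RiemannHypothesis.RiemannHypothesis.Theorems.HandoffLadderRungs
open Summit.RiemannHypothesis.RiemannHypothesis.Theorems.HandoffUpperClauses (nextPrime_eq)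

namespace Summit.RiemannHypothesis.RiemannHypothesis.Theorems.HandoffLadderRungsWide

variable {q Q : ℕ}

/-! ## §1 Downward closure -/

/-- `q ≤ Q` ⟹ `q⁺ ≤ Q⁺` (`Q` prime). [folklore] -/
theorem nextPrime_le_nextPrime (hQ : Q.Prime) (hqQ : q ≤ Q) : nextPrime q ≤ nextPrime Q := by
  rcases hqQ.eq_or_lt with rfl | hlt
  · exact le_rfl
  · exact (nextPrime_le hQ hlt).trans (lt_nextPrime Q).le

/-- **Downward closure**: `H(Q)` for one prime `Q` gives `H(q)` for every prime `q ≤ Q` (the windows are nested,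
`HandoffWindow.handoffH_anti`). [cite: Bombieri2000Weil, §4 (Thm 5, monotonicity in the support)] -/
theorem forall_handoffH_of_handoffH (hQ : Q.Prime) (H : HandoffH Q) :
    ∀ q : ℕ, q.Prime → q ≤ Q → HandoffH q := fun _ hq hqQ ↦
  Handoff.handoffH_anti (consecutivePrimes_nextPrime hq) (consecutivePrimes_nextPrime hQ) (nextPrime_le_nextPrime hQ hqQ) H

/-- «`H(q)` for all primes `q ≤ Q`» IS the single statement `H(Q)` (`Q` prime). [folklore] -/
theorem forall_handoffH_le_iff (hQ : Q.Prime) : (∀ q : ℕ, q.Prime → q ≤ Q → HandoffH q) ↔ HandoffH Q :=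
  ⟨fun h ↦ h Q hQ le_rfl, forall_handoffH_of_handoffH hQ⟩

/-- … i.e. Weil positivity on the last window's right end `(log Q⁺)/2`. [cite: Bombieri2000Weil, §4] -/
theorem forall_handoffH_le_iff_weilPositivityOn (hQ : Q.Prime) :
    (∀ q : ℕ, q.Prime → q ≤ Q → HandoffH q) ↔ WeilPositivityOn (Real.log (nextPrime Q) / 2) := by
  rw [forall_handoffH_le_iff hQ, handoffH_iff_weilPositivityOn hQ]

/-- … i.e. the TWO SECTOR INEQUALITIES at `(log Q⁺)/2` (the A1 certificate shape, both sectors needed and sufficient).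
[cite: Yoshida1992HermitianForms, Prop. 6 (p. 320); this track (parity split)] -/
theorem forall_handoffH_le_iff_sector_energies (hQ : Q.Prime) :
    (∀ q : ℕ, q.Prime → q ≤ Q → HandoffH q) ↔
      0 ≤ weilEvenGroundEnergy (Real.log (nextPrime Q) / 2) ∧ 0 ≤ weilOddGroundEnergy (Real.log (nextPrime Q) / 2) := by
  rw [forall_handoffH_le_iff_weilPositivityOn hQ, ← weilGroundEnergy_nonneg_iff_holds (HandoffMarginLaw.log_nextPrime_half_pos Q),
    weilGroundEnergy_eq_min_even_odd, le_min_iff]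

/-- A certificate ABOVE the last end also suffices: `0 ≤ ε_ev(c)`, `0 ≤ ε_od(c)` with `(log Q⁺)/2 ≤ c` give `H(q)` for all primes
`q ≤ Q`. [folklore] -/
theorem forall_handoffH_le_of_sector_energies (hQ : Q.Prime) {c : ℝ} (hc : Real.log (nextPrime Q) / 2 ≤ c)
    (hev : 0 ≤ weilEvenGroundEnergy c) (hod : 0 ≤ weilOddGroundEnergy c) :
    ∀ q : ℕ, q.Prime → q ≤ Q → HandoffH q :=
  forall_handoffH_of_handoffH hQ (HandoffAnalytic.handoffH_of_sector_energies (consecutivePrimes_nextPrime hQ) hc hev hod)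

/-! ## §2 The T2 sentence: `q ≤ 73` -/

/-- `nextPrime 73 = 79`. [folklore] -/
theorem nextPrime_seventyThree : nextPrime 73 = 79 :=
  nextPrime_eq (by norm_num) (by norm_num) (fun m h1 h2 ↦ by interval_cases m <;> norm_num)

/-- **T2's target is `H(73)`**: «`H(q)` for all primes `q ≤ 73`» ↔ `H(73)`. [folklore] -/
theorem forall_handoffH_le_73_iff : (∀ q : ℕ, q.Prime → q ≤ 73 → HandoffH q) ↔ HandoffH 73 :=
  forall_handoffH_le_iff (by norm_num)

/-- **… ↔ Weil positivity on `C((log 79)/2)`** (`(log 79)/2 = 2.1847…`). [cite: Bombieri2000Weil, §4] -/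
theorem forall_handoffH_le_73_iff_weilPositivityOn :
    (∀ q : ℕ, q.Prime → q ≤ 73 → HandoffH q) ↔ WeilPositivityOn (Real.log 79 / 2) := by
  rw [forall_handoffH_le_iff_weilPositivityOn (by norm_num), nextPrime_seventyThree]; norm_cast

/-- **… ↔ ONE two-sector bracket at `c = (log 79)/2`**: `0 ≤ ε_ev((log 79)/2) ∧ 0 ≤ ε_od((log 79)/2)` — exactly what «certified
for all `q ≤ 73`» means at `N = ∞`. [cite: Yoshida1992HermitianForms, Prop. 6 (p. 320); this track] -/
theorem forall_handoffH_le_73_iff_sector_energies :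
    (∀ q : ℕ, q.Prime → q ≤ 73 → HandoffH q) ↔
      0 ≤ weilEvenGroundEnergy (Real.log 79 / 2) ∧ 0 ≤ weilOddGroundEnergy (Real.log 79 / 2) := by
  rw [forall_handoffH_le_iff_sector_energies (by norm_num), nextPrime_seventyThree]; norm_cast

/-! ## §3 The wide table -/

/-- `c = 21/10`: `H(q)` for all primes `q < 61`, i.e. through `q = 59` (`61^5 < e^{21}`). [folklore] -/
theorem forall_handoffH_of_sector_energies_21_10 (hev : 0 ≤ weilEvenGroundEnergy (21 / 10)) (hod : 0 ≤ weilOddGroundEnergy (21 / 10)) :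
    ∀ q : ℕ, q.Prime → q < 61 → HandoffH q :=
  forall_handoffH_of_sector_energies (by norm_num) (natCast_le_exp_of_pow_lt (n := 5) (m := 21) (by norm_num) (by norm_num) (by norm_num)) hev hod

/-- **`c = 11/5 = 2.2`: `H(q)` for all primes `q < 79`, i.e. EVERY prime `q ≤ 73` — T2's list** (`79^5 < e^{22}`). [folklore] -/
theorem forall_handoffH_of_sector_energies_11_5 (hev : 0 ≤ weilEvenGroundEnergy (11 / 5)) (hod : 0 ≤ weilOddGroundEnergy (11 / 5)) :
    ∀ q : ℕ, q.Prime → q < 79 → HandoffH q :=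
  forall_handoffH_of_sector_energies (by norm_num) (natCast_le_exp_of_pow_lt (n := 5) (m := 22) (by norm_num) (by norm_num) (by norm_num)) hev hod

/-- The same list in T2's wording `q ≤ 73`, from the `11/5` certificate. [folklore] -/
theorem forall_handoffH_le_73_of_sector_energies_11_5 (hev : 0 ≤ weilEvenGroundEnergy (11 / 5)) (hod : 0 ≤ weilOddGroundEnergy (11 / 5)) :
    ∀ q : ℕ, q.Prime → q ≤ 73 → HandoffH q := fun q hq h73 ↦
  forall_handoffH_of_sector_energies_11_5 hev hod q hq (by omega)

/-- `c = (log 79)/2` (the MINIMAL bandwidth for T2's list): `H(q)` for all primes `q < 79`. [folklore] -/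
theorem forall_handoffH_of_sector_energies_log_79_half (hev : 0 ≤ weilEvenGroundEnergy (Real.log 79 / 2))
    (hod : 0 ≤ weilOddGroundEnergy (Real.log 79 / 2)) : ∀ q : ℕ, q.Prime → q < 79 → HandoffH q :=
  forall_handoffH_of_sector_energies (by norm_num)
    (by rw [mul_div_cancel₀ _ (two_ne_zero' ℝ), Real.exp_log (by norm_num)]; norm_num) hev hod

/-- `c = 9/4`: `H(q)` for all primes `q < 89`, i.e. through `q = 83` (`89^2 < e^{9}`). [folklore] -/
theorem forall_handoffH_of_sector_energies_9_4 (hev : 0 ≤ weilEvenGroundEnergy (9 / 4)) (hod : 0 ≤ weilOddGroundEnergy (9 / 4)) :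
    ∀ q : ℕ, q.Prime → q < 89 → HandoffH q :=
  forall_handoffH_of_sector_energies (by norm_num) (natCast_le_exp_of_pow_lt (n := 2) (m := 9) (by norm_num) (by norm_num) (by norm_num)) hev hod

/-- `c = 5/2`: `H(q)` for all primes `q < 139`, i.e. through `q = 137` (`139 < e^{5}`; the next prime `149 > e^5`). [folklore] -/
theorem forall_handoffH_of_sector_energies_5_2 (hev : 0 ≤ weilEvenGroundEnergy (5 / 2)) (hod : 0 ≤ weilOddGroundEnergy (5 / 2)) :
    ∀ q : ℕ, q.Prime → q < 139 → HandoffH q :=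
  forall_handoffH_of_sector_energies (by norm_num) (natCast_le_exp_of_pow_lt (n := 1) (m := 5) (by norm_num) (by norm_num) (by norm_num)) hev hod

/-- `c = 3`: `H(q)` for all primes `q < 401`, i.e. through `q = 397` (`401 < e^{6} = 403.4…`). [folklore] -/
theorem forall_handoffH_of_sector_energies_three (hev : 0 ≤ weilEvenGroundEnergy 3) (hod : 0 ≤ weilOddGroundEnergy 3) :
    ∀ q : ℕ, q.Prime → q < 401 → HandoffH q :=
  forall_handoffH_of_sector_energies (by norm_num) (natCast_le_exp_of_pow_lt (n := 1) (m := 6) (by norm_num) (by norm_num) (by norm_num)) hev hod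

/-- The same from Lean rungs (if ever proved or assumed): `WeilPositivityOn (11/5)` gives T2's list `q ≤ 73`. [folklore] -/
theorem forall_handoffH_le_73_of_weilPositivityOn_11_5 (hW : WeilPositivityOn (11 / 5)) :
    ∀ q : ℕ, q.Prime → q ≤ 73 → HandoffH q := by
  refine forall_handoffH_le_73_iff_weilPositivityOn.2 (hW.mono ?_)
  exact log_half_le_of_le_exp (by norm_num)
    (natCast_le_exp_of_pow_lt (P := 79) (n := 5) (m := 22) (by norm_num) (by norm_num) (by norm_num))

end Summit.RiemannHypothesis.RiemannHypothesis.Theorems.HandoffLadderRungsWide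

end
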